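import Summits.ABC.ABC.Theses.RibetTakahashiSplit
import Literature.NumberTheory.DiophantineGeometry.ConductorRadicalProofs

/-!
# Line `unramified-window-census` for crux `ManyPrimeValuationProduct`: the two open stubs are
# implied by the crux (certificate of the EQUIVALENT regime split)

Crux r2 of route `RibetTakahashiSplit` (stmt-ABC-1561): on the class of elliptic curves `E/ℚ`
semistable away from `2` with `≥ 4` odd multiplicative primes,
`T(E) = ∏_{p ∥ N} ord_p(Δ_min) ≤ C_ε N^ε`.

The line `unramified-window-census` (skeleton `Cruxes/ManyPrimeValuationProduct/Lines/
unramified-window-census.lean`, rev 3) reduces the crux to three regime statements; its composition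
`of_parts : stub_omegaLogLog → stub_midCensus → stub_giantMass → crux` is kernel-closed and
`stub_omegaLogLog` is landed (`Summit.ABC.ABC.Theorems.stub_omegaLogLog`).  This file proves the
two CONVERSE implications, with the stub statements written out verbatim:

* `sum_log_factorization_le_of_manyPrime` — the crux in logarithmic form:
  `Σ_{p ∥ N} log ord_p(Δ_min) ≤ ε log N + C` on the class;
* `giantMass_of_manyPrimeValuationProduct` — crux ⟹ `stub_giantMass`
  (a sub-sum of non-negative terms);
* `midCensus_of_manyPrimeValuationProduct` — crux ⟹ `stub_midCensus`
  (the crux at `ε²`: each counted prime carries `log ord_p > ε log log N`).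

Hence, given the landed `stub_omegaLogLog`, crux ⟺ stub_midCensus ∧ stub_giantMass: the line is an
equivalent re-indexing of the crux with no input of its own — the typed death certificate of the
line (lead prover-line-stmt-ABC-1561-1; the previous lead's `Converses.lean` evidence of
2026-08-16T02:38Z stated the same implications, re-derived here so that they are importable).
-/

-- `Summit.<Summit>.<Problem>` is the mandated summit-side namespace (CONVENTIONS §2); for the
-- single-conjunct summit `ABC` the two coincide, so the duplicate `ABC.ABC` is deliberate.
set_option linter.dupNamespace false

namespace Summit.ABC.ABC.Theorems

open scoped Classical
open Finset
open Summit.ABC.ABC.Theses.RibetTakahashiSplit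

namespace ManyPrimeValuationProduct

/-- Every factor of `T(E)` is `≥ 1`: a prime factor of the conductor divides the minimal
discriminant (`radical_conductorNorm_eq_holds`, PROVED in the tree). [folklore] -/
theorem one_le_factorization_of_mem_primeFactors_conductorNorm (W : WeierstrassCurve ℚ)
    [W.IsElliptic] {p : ℕ} (hp : p ∈ (W.conductorNorm ℤ).primeFactors) :
    1 ≤ (W.minimalDiscriminantNorm ℤ).factorization p := by
  have hrad : UniqueFactorizationMonoid.radical (W.conductorNorm ℤ) =
      UniqueFactorizationMonoid.radical (W.minimalDiscriminantNorm ℤ) :=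
    W.radical_conductorNorm_eq_holds
  have hpf : (W.conductorNorm ℤ).primeFactors = (W.minimalDiscriminantNorm ℤ).primeFactors := by
    rw [← Nat.primeFactors_radical, hrad, Nat.primeFactors_radical]
  rw [hpf] at hp
  obtain ⟨hpp, hpd, hne⟩ := Nat.mem_primeFactors.mp hp
  exact hpp.factorization_pos_of_dvd hne hpd

/-- **The crux in logarithmic form.** `ManyPrimeValuationProduct` gives, for every `ε > 0`, a `C`
with `Σ_{p ∥ N} log ord_p(Δ_min) ≤ ε log N + C` on the class (take logarithms in `T ≤ C₀ N^ε`;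
all factors of `T` are `≥ 1`). [folklore] -/
theorem sum_log_factorization_le_of_manyPrime (h : ManyPrimeValuationProduct) (ε : ℝ)
    (hε : 0 < ε) : ∃ C : ℝ, ∀ (W : WeierstrassCurve ℚ) [W.IsElliptic],
      (∀ p : ℕ, p.Prime → p ≠ 2 → ¬ p ^ 2 ∣ W.conductorNorm ℤ) →
      4 ≤ ((W.conductorNorm ℤ).primeFactors.filter
        (fun p => p ≠ 2 ∧ ¬ p ^ 2 ∣ W.conductorNorm ℤ)).card →
      ∑ p ∈ (W.conductorNorm ℤ).primeFactors.filter (fun p => ¬ p ^ 2 ∣ W.conductorNorm ℤ),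
        Real.log ((W.minimalDiscriminantNorm ℤ).factorization p) ≤
          ε * Real.log (W.conductorNorm ℤ) + C := by
  obtain ⟨C₀, hC₀⟩ := h ε hε
  refine ⟨Real.log (max C₀ 1), fun W _ hss h4 => ?_⟩
  have hT := hC₀ W hss h4
  set S := (W.conductorNorm ℤ).primeFactors.filter (fun p => ¬ p ^ 2 ∣ W.conductorNorm ℤ) with hS
  have hpos : ∀ p ∈ S, (0 : ℝ) < (((W.minimalDiscriminantNorm ℤ).factorization p : ℕ) : ℝ) := by
    intro p hp
    exact_mod_cast one_le_factorization_of_mem_primeFactors_conductorNorm W (Finset.mem_filter.mp hp).1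
  have hN0 : (0 : ℝ) < (W.conductorNorm ℤ : ℝ) := by
    have h0 : 0 < W.conductorNorm ℤ := W.conductorNorm_pos_holds
    exact_mod_cast h0
  have hTpos : (0 : ℝ) < ∏ p ∈ S, (((W.minimalDiscriminantNorm ℤ).factorization p : ℕ) : ℝ) :=
    Finset.prod_pos hpos
  have hNε : 0 < (W.conductorNorm ℤ : ℝ) ^ ε := Real.rpow_pos_of_pos hN0 _
  -- `T ≤ max(C₀,1) · N^ε`, then logarithms
  have hT' : ∏ p ∈ S, (((W.minimalDiscriminantNorm ℤ).factorization p : ℕ) : ℝ) ≤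
      max C₀ 1 * (W.conductorNorm ℤ : ℝ) ^ ε := by
    rw [← Nat.cast_prod]
    exact hT.trans (mul_le_mul_of_nonneg_right (le_max_left _ _) hNε.le)
  have hlog := Real.log_le_log hTpos hT'
  rw [Real.log_prod (fun p hp => (hpos p hp).ne'),
    Real.log_mul (lt_of_lt_of_le one_pos (le_max_right _ _)).ne' hNε.ne',
    Real.log_rpow hN0] at hlog
  linarith

end ManyPrimeValuationProduct

/-- **crux ⟹ `stub_giantMass`** (statement of the stub verbatim): the giant-exponent mass
`Σ_{p ∥ N, ord_p Δ_min > log N} log ord_p(Δ_min)` is a sub-sum of the non-negative terms of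
`log T`, so it is `≤ ε log N + C` whenever the crux holds. [folklore] -/
theorem giantMass_of_manyPrimeValuationProduct :
    Summit.ABC.ABC.Theses.RibetTakahashiSplit.ManyPrimeValuationProduct →
    ∀ ε : ℝ, 0 < ε → ∃ C : ℝ, ∀ (W : WeierstrassCurve ℚ) [W.IsElliptic],
      (∀ p : ℕ, p.Prime → p ≠ 2 → ¬ p ^ 2 ∣ W.conductorNorm ℤ) →
      4 ≤ ((W.conductorNorm ℤ).primeFactors.filter
        (fun p => p ≠ 2 ∧ ¬ p ^ 2 ∣ W.conductorNorm ℤ)).card →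
      ∑ p ∈ ((W.conductorNorm ℤ).primeFactors.filter (fun p => ¬ p ^ 2 ∣ W.conductorNorm ℤ)).filter
          (fun p => Real.log (W.conductorNorm ℤ) <
            (((W.minimalDiscriminantNorm ℤ).factorization p : ℕ) : ℝ)),
        Real.log ((W.minimalDiscriminantNorm ℤ).factorization p) ≤
          ε * Real.log (W.conductorNorm ℤ) + C := by
  intro h ε hε
  obtain ⟨C, hC⟩ := ManyPrimeValuationProduct.sum_log_factorization_le_of_manyPrime h ε hε
  refine ⟨C, fun W _ hss h4 => ?_⟩
  refine le_trans ?_ (hC W hss h4)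
  exact Finset.sum_le_sum_of_subset_of_nonneg (Finset.filter_subset _ _)
    (fun p _ _ => Real.log_natCast_nonneg _)

/-- **crux ⟹ `stub_midCensus`** (statement of the stub verbatim): apply the crux at `ε²`; each of
the `m` multiplicative primes with `log ord_p(Δ_min) > ε log log N` contributes more than
`ε log log N` to `log T ≤ ε² log N + C`, so `m · log log N ≤ ε log N + C/ε`. [folklore] -/
theorem midCensus_of_manyPrimeValuationProduct (h : ManyPrimeValuationProduct) :
    ∀ ε : ℝ, 0 < ε → ∃ C : ℝ, ∀ (W : WeierstrassCurve ℚ) [W.IsElliptic],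
      (∀ p : ℕ, p.Prime → p ≠ 2 → ¬ p ^ 2 ∣ W.conductorNorm ℤ) →
      4 ≤ ((W.conductorNorm ℤ).primeFactors.filter
        (fun p => p ≠ 2 ∧ ¬ p ^ 2 ∣ W.conductorNorm ℤ)).card →
      ((((W.conductorNorm ℤ).primeFactors.filter (fun p => ¬ p ^ 2 ∣ W.conductorNorm ℤ)).filter
          (fun p => ε * Real.log (Real.log (W.conductorNorm ℤ)) <
            Real.log ((W.minimalDiscriminantNorm ℤ).factorization p))).card : ℝ) *
        Real.log (Real.log (W.conductorNorm ℤ)) ≤ ε * Real.log (W.conductorNorm ℤ) + C := by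
  intro ε hε
  obtain ⟨C, hC⟩ := ManyPrimeValuationProduct.sum_log_factorization_le_of_manyPrime h (ε ^ 2)
    (pow_pos hε 2)
  refine ⟨C / ε, fun W _ hss h4 => ?_⟩
  have hsum := hC W hss h4
  set S := (W.conductorNorm ℤ).primeFactors.filter (fun p => ¬ p ^ 2 ∣ W.conductorNorm ℤ) with hS
  set LL := Real.log (Real.log (W.conductorNorm ℤ)) with hLL
  set F := S.filter (fun p => ε * LL <
    Real.log ((W.minimalDiscriminantNorm ℤ).factorization p)) with hF
  -- `#F · (ε LL) ≤ Σ_F log v_p ≤ Σ_S log v_p ≤ ε² log N + C`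
  have h1 : (F.card : ℝ) * (ε * LL) ≤
      ∑ p ∈ F, Real.log ((W.minimalDiscriminantNorm ℤ).factorization p) := by
    have := Finset.card_nsmul_le_sum F
      (fun p => Real.log ((W.minimalDiscriminantNorm ℤ).factorization p)) (ε * LL)
      (fun p hp => (Finset.mem_filter.mp hp).2.le)
    rwa [nsmul_eq_mul] at this
  have h2 : ∑ p ∈ F, Real.log ((W.minimalDiscriminantNorm ℤ).factorization p) ≤
      ∑ p ∈ S, Real.log ((W.minimalDiscriminantNorm ℤ).factorization p) :=
    Finset.sum_le_sum_of_subset_of_nonneg (Finset.filter_subset _ _)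
      (fun p _ _ => Real.log_natCast_nonneg _)
  have h3 : (F.card : ℝ) * LL * ε ≤ (ε * Real.log (W.conductorNorm ℤ) + C / ε) * ε := by
    have hring : (ε * Real.log (W.conductorNorm ℤ) + C / ε) * ε =
        ε ^ 2 * Real.log (W.conductorNorm ℤ) + C := by
      field_simp
    rw [hring]
    calc (F.card : ℝ) * LL * ε = (F.card : ℝ) * (ε * LL) := by ring
      _ ≤ _ := h1
      _ ≤ _ := h2
      _ ≤ _ := hsum
  exact le_of_mul_le_mul_right h3 hε

end Summit.ABC.ABC.Theorems
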